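import Mathlib.MeasureTheory.Function.Jacobian
import Mathlib.MeasureTheory.Integral.Pi
import Mathlib.MeasureTheory.Measure.Haar.OfBasis
import Mathlib.Analysis.SpecialFunctions.ImproperIntegrals
import Mathlib.LinearAlgebra.Matrix.NonsingularInverse
import Mathlib.LinearAlgebra.Matrix.ToLin
import Mathlib.Topology.Algebra.Module.FiniteDimension
import HarnessLib

/-!
# Borinsky's cone integral (AIHPD 2023 = arXiv:2008.12310, §4 Lemma 17 and its proof; the prefactor of Theorem 19 eq. (evalCintegral); §6 eq. (40)) — PROVED in the affine (`λ`-coordinate) form: the exponential integral over a simplicial cone equals `|det(u⁽¹⁾,…,u⁽ᵈ⁾)| / Π_k ⟨u⁽ᵏ⁾, w⟩` by the barycentric change of variables of the printed proof, the `ξ`-substitution onto the unit cube, and the chain-cone case `I^tr_{C_σ} = 1/Π_k r(A^σ_k)`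

Source [Borinsky2020]: M. Borinsky, "Tropical Monte Carlo quadrature for Feynman integrals", Ann. Inst. Henri Poincaré D 10
(2023) 635–685 = arXiv:2008.12310v2; e-print `tropical.tex` (pub-qed HOME `data/lit/sources/.cache/2008.12310/`; flat theorem counter as
in the companion files — `\begin{subtheorem}` makes 8a/8b one number, so `lmm:cone_integral` at tex l.742 is **Lemma 17** and
`thm:secdec` at l.776 is Theorem 19), VERBATIM (l.735–774): "A cone C is simplicial if it is generated as, C = {Σ_{k=1}^d λ_k u^{(k)} :
λ_k ≥ 0} where u^{(1)}, … u^{(d)} are linear independent. … A feature of simplicial cones is that there are convenient coordinates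
describing points in their interior. This fact is important while proving the following lemma: **Lemma 17.** If a pointed simplicial cone
C ⊂ ℝⁿ/𝟙ℝ is generated by linear independent vectors u^{(1)}, …, u^{(n−1)} ∈ ℝⁿ/𝟙ℝ, i.e. C = {Σ_{k=1}^{n−1} λ_k u^{(k)} : λ_k ≥ 0},
w ∈ ℝⁿ with ⟨𝟙, w⟩ = 0 and ⟨y, w⟩ > 0 for all y ∈ C∖{0}, then ∫_{Exp(C)} x^{−w} f(x) Ω = |det(u^{(1)}, …, u^{(n−1)}, 𝟙)| /
Π_{k=1}^{n−1} ⟨u^{(k)}, w⟩ · ∫_{[0,1]^{n−1}} f(x(ξ)) Π_{k=1}^{n−1} dξ_k, where f : ℙ^{n−1}_{>0} → ℂ is a measurable homogeneous function of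
degree 0 and x(ξ) ∈ Exp(C) is given component-wise by x_k = Π_{i=1}^{n−1} ξ_i^{−u_k^{(i)}/⟨u^{(i)},w⟩}. … *Proof.* Start by changing to
logarithmic coordinates x = e^y, ∫_{Exp(C)} x^{−w} f(x) Ω = ∫_C e^{−⟨y,w⟩} f(e^y) Ω̃ … Using barycentric coordinates y = Σ_{k=1}^{n−1}
u^{(k)} λ_k shows that this is equal to = |det(u^{(1)}, …, u^{(n−1)}, 𝟙)| ∫_{ℝ^{n−1}_{>0}} e^{−Σ_{k=1}^{n−1} λ_k ⟨u^{(k)},w⟩}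
f(e^{Σ_k λ_k u^{(k)}}) Π_{k=1}^{n−1} dλ_k. … As ⟨y, w⟩ > 0 for all y ∈ C∖{0}, it follows that ⟨u^{(k)}, w⟩ > 0 for all k ∈ {1,…,n−1}.
We can therefore change variables via λ_k = −(1/⟨u^{(k)},w⟩) log ξ_k which proves the statement." · Theorem 19 (geometric sector
decomposition), eq. (evalCintegral): "I_C[f] = |det(u^{(C,1)}, …, u^{(C,n−1)}, 𝟙)| / Π_{k=1}^{n−1} ⟨u^{(C,k)}, w^{(C)}⟩ ∫_{[0,1]^{n−1}}
f(x^{(C)}(ξ)) Π dξ_k" with "the prefactor … is finite and positive for each C" (l.776–802) · §6.2 eq. (40): "I^tr = Σ_{σ∈S_n} I^tr_{C_σ}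
with I^tr_{C_σ} = 1/Π_{k=1}^{n−1} r(A^σ_k)" (the generalized-permutahedron case, where |det| = 1, l.1081).

TYPING. We work in the AFFINE chart of the printed proof — the `λ`-coordinates of the simplicial cone and its image under the
generator matrix — which is also the form the pub-qed IR/SE lane uses (`irse/B-SAMPLER-DESIGN.md` §6 (M3) "FAN LAW": chain cone
= the orthant {τ ≥ 0} ⊂ ℝ^{n−1}, rays g_j, "M_σ := |det G_σ|·Π_j 1/m₁(g_j) (the cone's tropical mass); draw y_j ~ Exp(rate m₁(g_j))
independently; set τ = Σ_j y_j g_j"): `orthant d` = ℝ^d_{>0}; `coneMap U` = the linear map λ ↦ U λ = Σ_k λ_k u^{(k)} for a generator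
matrix `U : Matrix (Fin d) (Fin d) ℝ` whose k-th column is u^{(k)} (`coneMap_apply`, `det_coneMap`); the cone is `coneMap U '' orthant d`;
the linear functional is `y ↦ Σ_i w_i y_i` and `⟨u^{(k)}, w⟩ = Σ_i w_i U_{ik}` (`sum_mul_mulVec`). PROVED: the one-dimensional and
product exponential integrals `∫_{ℝ^d_{>0}} e^{−Σ_k c_k λ_k} dλ = Π_k 1/c_k` (`integral_orthant_exp_neg_sum`, Fubini + Mathlib's
`integral_exp_mul_Ioi`); the barycentric change of variables of the printed proof, for any integrand,
`∫_{U(ℝ^d_{>0})} φ = |det U| ∫_{ℝ^d_{>0}} φ∘U` (`integral_coneMap_image`, Mathlib's change-of-variables theorem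
`integral_image_eq_integral_abs_det_fderiv_smul`) and with the exponential weight split off (`integral_cone_mul_exp_neg` — the display
"= |det(u…)| ∫_{ℝ^{n−1}_{>0}} e^{−Σ λ_k⟨u^{(k)},w⟩} f(…) Π dλ_k"); **the prefactor**: `∫_{U(ℝ^d_{>0})} e^{−⟨y,w⟩} dy = |det U| · Π_k 1/⟨u^{(k)},w⟩`
for `det U ≠ 0` and `⟨u^{(k)}, w⟩ > 0` (`integral_cone_exp_neg` = Lemma 17 / (evalCintegral) with f ≡ 1, i.e. I^tr_C; eq. (40) is the case
|det| = 1, ⟨u^{(σ,k)}, w⟩ = r(A^σ_k)); and the SAMPLING reading used by the lane: with M := |det U|·Π_k 1/c_k, c_k = ⟨u^{(k)},w⟩, the law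
"λ_k ~ Exp(c_k) independent, τ = U λ" integrates every φ against the normalised cone density e^{−⟨τ,w⟩}/M
(`integral_orthant_expDensity_comp_coneMap`: ∫_{ℝ^d_{>0}} φ(Uλ) Π_k c_k e^{−c_k λ_k} dλ = (1/M) ∫_{U(ℝ^d_{>0})} φ(y) e^{−⟨y,w⟩} dy).
The last step of the printed proof, the substitution λ_k = −log ξ_k/c_k onto the unit cube, is `integral_unitCube_comp_logMap`
(`logMap`, `hasFDerivAt_logMap`, `injOn_logMap`, `logMap_image`; Jacobian Π_k 1/(c_k ξ_k), e^{−Σ c_k λ_k(ξ)} = Π ξ_k), giving the full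
affine Lemma 17 `integral_cone_mul_exp_neg_eq_unitCube`: ∫_{U(ℝ^d_{>0})} ψ e^{−⟨y,w⟩} = |det U|·Π_k(1/c_k)·∫_{(0,1)^d} ψ(U λ(ξ)) dξ.
Finally the CHAIN (Weyl-chamber) cone of §6 in position coordinates: generator matrix `chainMatrix d` (column k = 1_{A_{k+1}}, the
lane's "w(r) = Σ_L r_L 1_{S_L}"), `det_chainMatrix` (= 1, "it is obvious that |det(…)| = 1", l.1081), `sum_mul_chainMatrix`
(⟨1_{A_{k+1}}, w⟩ = Σ_{j≤k} w_j), **eq. (40) `integral_chainCone_exp_neg`: ∫_{chain cone} e^{−⟨y,w⟩} = Π_k 1/(Σ_{j≤k} w_j)** (= 1/Π r(A^σ_k))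
and its sampling law `integral_orthant_expDensity_comp_chainMatrix` (independent gaps τ_k ~ Exp(Σ_{j≤k} w_j)).
NOT typed: the projective bookkeeping (ℝⁿ/𝟙ℝ, the form Ω, ⟨𝟙,w⟩ = 0, homogeneity of f), the relabelling by a permutation σ (we work
in position coordinates along the chain), the identification of w with generalized-permutahedron data (that is Lemma 26, typed in
`GeneralizedPermutahedronVertex`: Σ_{A^σ_k} w^{(σ,z)} = z(A^σ_k)), and Theorem 19's summation over a fan. (Filed by the pub-qed literature seat gen 23 for the IR/SE lane's
sector-decomposition row — human ruling (a); `irse/lit/SECTOR-DECOMP-EXTRACT-lit.md` §3.3; VALUE-FREE. independent recomputation;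
certified where stated, statistical where stated; no new-physics claim.)
-/

namespace Literature.MathematicalPhysics.QuantumFieldTheory.Borinsky2020

open MeasureTheory Set Real Finset Matrix

noncomputable section

variable {d : ℕ}

/-! ## The λ-orthant and the product exponential integral -/

/-- The open orthant `ℝ^d_{>0}` — the barycentric coordinates `λ_k > 0` of the printed proof ("∫_{ℝ^{n−1}_{>0}} … Π dλ_k").
[cite: Borinsky2020, Lemma 17 proof (tex l.762–766)] -/
def orthant (d : ℕ) : Set (Fin d → ℝ) := Set.univ.pi fun _ => Ioi (0 : ℝ)

/-- The orthant is measurable. Plumbing. [cite: Borinsky2020, Lemma 17 proof (tex l.762–766)] -/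
theorem measurableSet_orthant : MeasurableSet (orthant d) :=
  MeasurableSet.univ_pi fun _ => measurableSet_Ioi

/-- `λ ∈ ℝ^d_{>0} ↔ ∀ k, 0 < λ_k`. Plumbing. [cite: Borinsky2020, Lemma 17 proof (tex l.762–766)] -/
theorem mem_orthant {l : Fin d → ℝ} : l ∈ orthant d ↔ ∀ k, 0 < l k := by
  simp [orthant]

/-- The one-dimensional exponential integral `∫_0^∞ e^{−c λ} dλ = 1/c` (`c > 0`) — the `k`-th factor of the barycentric integral.
Elementary (Mathlib `integral_exp_mul_Ioi`). [cite: Borinsky2020, Lemma 17 proof (tex l.762–774)] -/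
theorem integral_Ioi_exp_neg_mul {c : ℝ} (hc : 0 < c) : ∫ x in Ioi (0 : ℝ), exp (-(c * x)) = 1 / c := by
  have h := integral_exp_mul_Ioi (a := -c) (by linarith) 0
  simp only [neg_mul, mul_zero, exp_zero] at h
  rw [h, neg_div_neg_eq]

/-- **`∫_{ℝ^d_{>0}} e^{−Σ_k c_k λ_k} dλ = Π_k 1/c_k`** for `c_k > 0` (Fubini over the `d` factors). This is the integral left after the
barycentric substitution when `f ≡ 1`. [cite: Borinsky2020, Lemma 17 proof (tex l.762–774)] -/
theorem integral_orthant_exp_neg_sum (c : Fin d → ℝ) (hc : ∀ k, 0 < c k) :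
    ∫ l in orthant d, exp (-∑ k, c k * l k) = ∏ k, 1 / c k := by
  unfold orthant
  rw [volume_pi, Measure.restrict_pi_pi]
  have hpt : (fun l : Fin d → ℝ => exp (-∑ k, c k * l k)) = fun l => ∏ k, exp (-(c k * l k)) := by
    funext l
    rw [← exp_sum, ← Finset.sum_neg_distrib]
  rw [hpt, integral_fin_nat_prod_eq_prod (fun k x => exp (-(c k * x)))]
  exact Finset.prod_congr rfl fun k _ => integral_Ioi_exp_neg_mul (hc k)

/-! ## The generator matrix and the barycentric change of variables -/

/-- The linear map `λ ↦ U λ = Σ_k λ_k u^{(k)}` of the barycentric coordinates ("y = Σ_{k} u^{(k)} λ_k"), for a generator matrix `U`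
whose `k`-th column is `u^{(k)}`. [cite: Borinsky2020, Lemma 17 proof (tex l.764)] -/
def coneMap (U : Matrix (Fin d) (Fin d) ℝ) : (Fin d → ℝ) →L[ℝ] (Fin d → ℝ) :=
  LinearMap.toContinuousLinearMap (Matrix.toLin' U)

/-- `coneMap U λ = U λ`. Plumbing. [cite: Borinsky2020, Lemma 17 proof (tex l.764)] -/
theorem coneMap_apply (U : Matrix (Fin d) (Fin d) ℝ) (l : Fin d → ℝ) : coneMap U l = U *ᵥ l := by
  simp [coneMap]

/-- `det (coneMap U) = det U` ("|det(u^{(1)}, …, u^{(n−1)}, 𝟙)|" in the affine chart). [cite: Borinsky2020, Lemma 17 (tex l.745)] -/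
theorem det_coneMap (U : Matrix (Fin d) (Fin d) ℝ) : (coneMap U).det = U.det := by
  unfold coneMap ContinuousLinearMap.det
  rw [LinearMap.coe_toContinuousLinearMap, LinearMap.det_toLin']

/-- `coneMap U` is injective on the orthant when `det U ≠ 0` (the generators are "linear independent").
[cite: Borinsky2020, Lemma 17 (tex l.743–744)] -/
theorem injOn_coneMap {U : Matrix (Fin d) (Fin d) ℝ} (hU : U.det ≠ 0) : Set.InjOn (coneMap U) (orthant d) := by
  intro a _ b _ h
  rw [coneMap_apply, coneMap_apply] at h
  exact (Matrix.mulVec_injective_iff_isUnit.mpr ((Matrix.isUnit_iff_isUnit_det U).mpr hU.isUnit)) h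

/-- `⟨U λ, w⟩ = Σ_k λ_k ⟨u^{(k)}, w⟩` with `⟨u^{(k)}, w⟩ = Σ_i w_i U_{ik}` ("e^{−Σ_k λ_k ⟨u^{(k)},w⟩}"). Elementary.
[cite: Borinsky2020, Lemma 17 proof (tex l.764)] -/
theorem sum_mul_mulVec (U : Matrix (Fin d) (Fin d) ℝ) (w l : Fin d → ℝ) :
    ∑ i, w i * (U *ᵥ l) i = ∑ k, (∑ i, w i * U i k) * l k := by
  simp only [Matrix.mulVec, dotProduct, Finset.mul_sum, Finset.sum_mul]
  rw [Finset.sum_comm]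
  exact Finset.sum_congr rfl fun k _ => Finset.sum_congr rfl fun i _ => by ring

/-- **The barycentric change of variables** ("Using barycentric coordinates y = Σ u^{(k)} λ_k shows that this is equal to
|det(u^{(1)},…)| ∫_{ℝ^{n−1}_{>0}} …"): for every integrand `φ` and `det U ≠ 0`, `∫_{U(ℝ^d_{>0})} φ(y) dy = |det U| · ∫_{ℝ^d_{>0}} φ(U λ) dλ`
(Mathlib's change-of-variables theorem for the injective linear map `coneMap U`). [cite: Borinsky2020, Lemma 17 proof (tex l.762–766)] -/
theorem integral_coneMap_image {U : Matrix (Fin d) (Fin d) ℝ} (hU : U.det ≠ 0) (φ : (Fin d → ℝ) → ℝ) :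
    ∫ y in coneMap U '' orthant d, φ y = |U.det| * ∫ l in orthant d, φ (U *ᵥ l) := by
  have h := integral_image_eq_integral_abs_det_fderiv_smul volume measurableSet_orthant
    (fun x _ => (coneMap U).hasFDerivWithinAt) (injOn_coneMap hU) φ
  rw [h]
  simp only [det_coneMap, coneMap_apply, smul_eq_mul]
  exact integral_const_mul _ _

/-- The same with the exponential weight split off — the printed display "= |det(u^{(1)}, …, u^{(n−1)}, 𝟙)| ∫_{ℝ^{n−1}_{>0}}
e^{−Σ_{k} λ_k ⟨u^{(k)},w⟩} f(e^{Σ_k λ_k u^{(k)}}) Π dλ_k" (with `ψ` for `f ∘ exp`). [cite: Borinsky2020, Lemma 17 proof (tex l.762–766)] -/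
theorem integral_cone_mul_exp_neg {U : Matrix (Fin d) (Fin d) ℝ} (hU : U.det ≠ 0) (w : Fin d → ℝ) (ψ : (Fin d → ℝ) → ℝ) :
    ∫ y in coneMap U '' orthant d, ψ y * exp (-∑ i, w i * y i)
      = |U.det| * ∫ l in orthant d, ψ (U *ᵥ l) * exp (-∑ k, (∑ i, w i * U i k) * l k) := by
  rw [integral_coneMap_image hU]
  simp_rw [sum_mul_mulVec]

/-- **Lemma 17's prefactor / Theorem 19 eq. (evalCintegral) with f ≡ 1 / eq. (40)**: for `det U ≠ 0` and `⟨u^{(k)}, w⟩ > 0` for all `k`,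
`∫_{U(ℝ^d_{>0})} e^{−⟨y,w⟩} dy = |det U| · Π_k 1/⟨u^{(k)}, w⟩` — the tropical normalisation `I^tr_C` of the cone (the IR/SE lane's
"M_σ = |det G_σ| Π_j 1/m₁(g_j)"). [cite: Borinsky2020, Lemma 17 (tex l.742–774); Theorem 19 eq. (evalCintegral); eq. (40)] -/
theorem integral_cone_exp_neg {U : Matrix (Fin d) (Fin d) ℝ} (hU : U.det ≠ 0) (w : Fin d → ℝ)
    (hc : ∀ k, 0 < ∑ i, w i * U i k) :
    ∫ y in coneMap U '' orthant d, exp (-∑ i, w i * y i) = |U.det| * ∏ k, 1 / (∑ i, w i * U i k) := by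
  have h := integral_cone_mul_exp_neg hU w (fun _ => 1)
  simp only [one_mul] at h
  rw [h, integral_orthant_exp_neg_sum _ hc]

/-- The prefactor is positive ("finite and positive for each C"). [cite: Borinsky2020, Theorem 19 (tex l.800–802)] -/
theorem cone_prefactor_pos {U : Matrix (Fin d) (Fin d) ℝ} (hU : U.det ≠ 0) (w : Fin d → ℝ)
    (hc : ∀ k, 0 < ∑ i, w i * U i k) : 0 < |U.det| * ∏ k, 1 / (∑ i, w i * U i k) :=
  mul_pos (abs_pos.mpr hU) (Finset.prod_pos fun k _ => one_div_pos.mpr (hc k))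

/-! ## The sampling reading: independent exponentials along the generators -/

/-- **Sampling the cone density by independent exponentials** (the lane's "draw y_j ~ Exp(rate m₁(g_j)) independently; set
τ = Σ_j y_j g_j", i.e. the printed substitution read as a law): with `c_k = ⟨u^{(k)}, w⟩ > 0` and `M = |det U|·Π_k 1/c_k`, for every `φ`,
`∫_{ℝ^d_{>0}} φ(Uλ) · Π_k (c_k e^{−c_k λ_k}) dλ = (1/M) · ∫_{U(ℝ^d_{>0})} φ(y) e^{−⟨y,w⟩} dy` — the push-forward of the product of
`Exp(c_k)` laws under `λ ↦ Uλ` is the normalised density `e^{−⟨y,w⟩}/M` on the cone. Elementary consequence of `integral_cone_mul_exp_neg`.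
[cite: Borinsky2020, Lemma 17 proof (tex l.762–774); Proposition 21 (Algorithm 3 samples µ^tr)] -/
theorem integral_orthant_expDensity_comp_coneMap {U : Matrix (Fin d) (Fin d) ℝ} (hU : U.det ≠ 0) (w : Fin d → ℝ)
    (hc : ∀ k, 0 < ∑ i, w i * U i k) (φ : (Fin d → ℝ) → ℝ) :
    ∫ l in orthant d, φ (U *ᵥ l) * ∏ k, ((∑ i, w i * U i k) * exp (-((∑ i, w i * U i k) * l k)))
      = (1 / (|U.det| * ∏ k, 1 / (∑ i, w i * U i k)))
          * ∫ y in coneMap U '' orthant d, φ y * exp (-∑ i, w i * y i) := by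
  rw [integral_cone_mul_exp_neg hU w φ]
  have hM : |U.det| ≠ 0 := abs_ne_zero.mpr hU
  have hP : ∏ k, (∑ i, w i * U i k) ≠ 0 := Finset.prod_ne_zero_iff.mpr fun k _ => (hc k).ne'
  -- split the product density into (Π c_k) · e^{−Σ c_k λ_k}
  have hdens : ∀ l : Fin d → ℝ, ∏ k, ((∑ i, w i * U i k) * exp (-((∑ i, w i * U i k) * l k)))
      = (∏ k, ∑ i, w i * U i k) * exp (-∑ k, (∑ i, w i * U i k) * l k) := by
    intro l
    rw [Finset.prod_mul_distrib, ← exp_sum, ← Finset.sum_neg_distrib]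
  simp_rw [hdens]
  have hcomm : ∀ l : Fin d → ℝ, φ (U *ᵥ l) * ((∏ k, ∑ i, w i * U i k) * exp (-∑ k, (∑ i, w i * U i k) * l k))
      = (∏ k, ∑ i, w i * U i k) * (φ (U *ᵥ l) * exp (-∑ k, (∑ i, w i * U i k) * l k)) := by
    intro l; ring
  simp_rw [hcomm]
  rw [integral_const_mul]
  have hprod : ∏ k, 1 / (∑ i, w i * U i k) = 1 / ∏ k, ∑ i, w i * U i k := by
    rw [Finset.prod_div_distrib, Finset.prod_const_one]
  rw [hprod]
  field_simp


/-! ## The substitution `λ_k = −log ξ_k / ⟨u^{(k)},w⟩` onto the unit cube (the last step of the printed proof) -/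

/-- The open unit cube `(0,1)^d` — the `ξ`-coordinates of Lemma 17 ("∫_{[0,1]^{n−1}} … Π dξ_k"; the boundary is Lebesgue-null).
[cite: Borinsky2020, Lemma 17 (tex l.745–748)] -/
def unitCube (d : ℕ) : Set (Fin d → ℝ) := Set.univ.pi fun _ => Ioo (0 : ℝ) 1

/-- The unit cube is measurable. Plumbing. [cite: Borinsky2020, Lemma 17 (tex l.745–748)] -/
theorem measurableSet_unitCube : MeasurableSet (unitCube d) :=
  MeasurableSet.univ_pi fun _ => measurableSet_Ioo

/-- `ξ ∈ (0,1)^d ↔ ∀ k, 0 < ξ_k < 1`. Plumbing. [cite: Borinsky2020, Lemma 17 (tex l.745–748)] -/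
theorem mem_unitCube {ξ : Fin d → ℝ} : ξ ∈ unitCube d ↔ ∀ k, 0 < ξ k ∧ ξ k < 1 := by
  simp [unitCube]

/-- The substitution of the printed proof, `λ_k = −(1/c_k) log ξ_k` ("We can therefore change variables via
λ_k = −(1/⟨u^{(k)},w⟩) log ξ_k"). [cite: Borinsky2020, Lemma 17 proof (tex l.773–774)] -/
def logMap (c : Fin d → ℝ) (ξ : Fin d → ℝ) : Fin d → ℝ := fun k => -(c k)⁻¹ * Real.log (ξ k)

/-- The derivative of `logMap c` at `ξ` (all `ξ_k ≠ 0`) is the diagonal map with entries `−1/(c_k ξ_k)`. Elementary calculus.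
[cite: Borinsky2020, Lemma 17 proof (tex l.773–774)] -/
theorem hasFDerivAt_logMap (c : Fin d → ℝ) {ξ : Fin d → ℝ} (hξ : ∀ k, ξ k ≠ 0) :
    HasFDerivAt (logMap c) (coneMap (Matrix.diagonal fun k => -(c k)⁻¹ * (ξ k)⁻¹)) ξ := by
  have h : HasFDerivAt (fun (x : Fin d → ℝ) (k : Fin d) => -(c k)⁻¹ * Real.log (x k))
      (ContinuousLinearMap.pi fun k =>
        (-(c k)⁻¹) • ((ξ k)⁻¹ • ContinuousLinearMap.proj (R := ℝ) (φ := fun _ : Fin d => ℝ) k)) ξ := by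
    rw [hasFDerivAt_pi]
    intro k
    have h1 : HasFDerivAt (fun f : Fin d → ℝ => f k)
        (ContinuousLinearMap.proj (R := ℝ) (φ := fun _ : Fin d => ℝ) k) ξ := hasFDerivAt_apply k ξ
    have h2 := (Real.hasDerivAt_log (hξ k)).comp_hasFDerivAt ξ h1
    exact h2.const_mul (-(c k)⁻¹)
  have heq : (ContinuousLinearMap.pi fun k =>
        (-(c k)⁻¹) • ((ξ k)⁻¹ • ContinuousLinearMap.proj (R := ℝ) (φ := fun _ : Fin d => ℝ) k))
      = coneMap (Matrix.diagonal fun k => -(c k)⁻¹ * (ξ k)⁻¹) := by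
    ext v k
    simp [coneMap_apply, Matrix.mulVec_diagonal, mul_assoc]
  rw [← heq]
  exact h

/-- `logMap c` is injective on the unit cube (`c_k > 0`; `log` is injective on `(0,∞)`). [cite: Borinsky2020, Lemma 17 proof (tex l.773–774)] -/
theorem injOn_logMap (c : Fin d → ℝ) (hc : ∀ k, 0 < c k) : Set.InjOn (logMap c) (unitCube d) := by
  intro a ha b hb h
  funext k
  have hk := congr_fun h k
  simp only [logMap] at hk
  have hck : -(c k)⁻¹ ≠ 0 := neg_ne_zero.mpr (inv_ne_zero (hc k).ne')
  have hlog : Real.log (a k) = Real.log (b k) := mul_left_cancel₀ hck hk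
  exact Real.log_injOn_pos (Set.mem_Ioi.mpr (mem_unitCube.mp ha k).1) (Set.mem_Ioi.mpr (mem_unitCube.mp hb k).1) hlog

/-- `logMap c` maps the unit cube ONTO the orthant (`c_k > 0`): `λ_k = −log ξ_k/c_k ∈ (0,∞) ↔ ξ_k ∈ (0,1)`, with inverse
`ξ_k = e^{−c_k λ_k}`. [cite: Borinsky2020, Lemma 17 proof (tex l.773–774)] -/
theorem logMap_image (c : Fin d → ℝ) (hc : ∀ k, 0 < c k) : logMap c '' unitCube d = orthant d := by
  ext l
  constructor
  · rintro ⟨ξ, hξ, rfl⟩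
    rw [mem_orthant]
    intro k
    obtain ⟨h0, h1⟩ := mem_unitCube.mp hξ k
    have hlog : Real.log (ξ k) < 0 := Real.log_neg h0 h1
    have hci : 0 < (c k)⁻¹ := inv_pos.mpr (hc k)
    show 0 < -(c k)⁻¹ * Real.log (ξ k)
    nlinarith
  · intro hl
    refine ⟨fun k => Real.exp (-(c k * l k)), ?_, ?_⟩
    · rw [mem_unitCube]
      intro k
      refine ⟨Real.exp_pos _, ?_⟩
      rw [Real.exp_lt_one_iff]
      have h1 := mem_orthant.mp hl k
      have h2 := hc k
      nlinarith
    · funext k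
      simp only [logMap, Real.log_exp]
      field_simp [(hc k).ne']

/-- **The ξ-substitution as an integral identity**: for `c_k > 0` and any `G`,
`∫_{(0,1)^d} G(λ(ξ)) dξ = (Π_k c_k) · ∫_{ℝ^d_{>0}} G(λ) e^{−Σ_k c_k λ_k} dλ`, `λ(ξ)_k = −log ξ_k / c_k` — i.e. under `ξ` uniform on the
cube the `λ_k` are independent `Exp(c_k)`. Proved by Mathlib's change-of-variables theorem with Jacobian `Π_k 1/(c_k ξ_k)` and
`e^{−Σ c_k λ_k(ξ)} = Π_k ξ_k`. [cite: Borinsky2020, Lemma 17 proof (tex l.773–774)] -/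
theorem integral_unitCube_comp_logMap (c : Fin d → ℝ) (hc : ∀ k, 0 < c k) (G : (Fin d → ℝ) → ℝ) :
    ∫ ξ in unitCube d, G (logMap c ξ) = (∏ k, c k) * ∫ l in orthant d, G l * exp (-∑ k, c k * l k) := by
  have hderiv : ∀ ξ ∈ unitCube d, HasFDerivWithinAt (logMap c)
      (coneMap (Matrix.diagonal fun k => -(c k)⁻¹ * (ξ k)⁻¹)) (unitCube d) ξ :=
    fun ξ hξ => (hasFDerivAt_logMap c (fun k => (mem_unitCube.mp hξ k).1.ne')).hasFDerivWithinAt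
  have hJ := integral_image_eq_integral_abs_det_fderiv_smul volume measurableSet_unitCube hderiv (injOn_logMap c hc)
    (fun l => G l * ((∏ k, c k) * exp (-∑ k, c k * l k)))
  rw [logMap_image c hc] at hJ
  calc ∫ ξ in unitCube d, G (logMap c ξ)
      = ∫ ξ in unitCube d, |(coneMap (Matrix.diagonal fun k => -(c k)⁻¹ * (ξ k)⁻¹)).det| •
          (G (logMap c ξ) * ((∏ k, c k) * exp (-∑ k, c k * logMap c ξ k))) := by
        refine setIntegral_congr_fun measurableSet_unitCube fun ξ hξ => ?_
        have hξ' := mem_unitCube.mp hξ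
        simp only [det_coneMap, Matrix.det_diagonal, smul_eq_mul]
        have hexp : exp (-∑ k, c k * logMap c ξ k) = ∏ k, ξ k := by
          have hs : -∑ k, c k * logMap c ξ k = ∑ k, Real.log (ξ k) := by
            rw [← Finset.sum_neg_distrib]
            refine Finset.sum_congr rfl fun k _ => ?_
            simp only [logMap]
            field_simp [(hc k).ne']
          rw [hs, exp_sum]
          exact Finset.prod_congr rfl fun k _ => Real.exp_log (hξ' k).1
        rw [hexp]
        have habs : |∏ k, (-(c k)⁻¹ * (ξ k)⁻¹)| = ∏ k, ((c k)⁻¹ * (ξ k)⁻¹) := by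
          rw [Finset.abs_prod]
          refine Finset.prod_congr rfl fun k _ => ?_
          have hpos : 0 < (c k)⁻¹ * (ξ k)⁻¹ := mul_pos (inv_pos.mpr (hc k)) (inv_pos.mpr (hξ' k).1)
          rw [neg_mul, abs_neg, abs_of_pos hpos]
        rw [habs]
        have hprod : (∏ k, ((c k)⁻¹ * (ξ k)⁻¹)) * ((∏ k, c k) * ∏ k, ξ k) = 1 := by
          rw [← Finset.prod_mul_distrib, ← Finset.prod_mul_distrib]
          refine Finset.prod_eq_one fun k _ => ?_
          have h1 := (hc k).ne'
          have h2 := (hξ' k).1.ne'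
          field_simp
        calc G (logMap c ξ)
            = G (logMap c ξ) * ((∏ k, ((c k)⁻¹ * (ξ k)⁻¹)) * ((∏ k, c k) * ∏ k, ξ k)) := by rw [hprod, mul_one]
          _ = (∏ k, ((c k)⁻¹ * (ξ k)⁻¹)) * (G (logMap c ξ) * ((∏ k, c k) * ∏ k, ξ k)) := by ring
    _ = ∫ l in orthant d, G l * ((∏ k, c k) * exp (-∑ k, c k * l k)) := hJ.symm
    _ = (∏ k, c k) * ∫ l in orthant d, G l * exp (-∑ k, c k * l k) := by
        rw [← integral_const_mul]
        refine setIntegral_congr_fun measurableSet_orthant fun l _ => ?_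
        ring

/-- **Lemma 17 in the affine chart, in full**: for `det U ≠ 0`, `c_k = ⟨u^{(k)}, w⟩ > 0` and any `ψ`,
`∫_{U(ℝ^d_{>0})} ψ(y) e^{−⟨y,w⟩} dy = |det U| · Π_k (1/c_k) · ∫_{(0,1)^d} ψ(U λ(ξ)) dξ` with `λ(ξ)_k = −log ξ_k / c_k` — the printed
"|det(u^{(1)},…,u^{(n−1)},𝟙)| / Π_k ⟨u^{(k)},w⟩ · ∫_{[0,1]^{n−1}} f(x(ξ)) Π dξ_k" with `x(ξ) = exp(U λ(ξ))`, i.e.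
`x_k = Π_i ξ_i^{−u_k^{(i)}/⟨u^{(i)},w⟩}`, and `ψ = f ∘ exp`. [cite: Borinsky2020, Lemma 17 (tex l.742–774); Theorem 19 eq. (evalCintegral)] -/
theorem integral_cone_mul_exp_neg_eq_unitCube {U : Matrix (Fin d) (Fin d) ℝ} (hU : U.det ≠ 0) (w : Fin d → ℝ)
    (hc : ∀ k, 0 < ∑ i, w i * U i k) (ψ : (Fin d → ℝ) → ℝ) :
    ∫ y in coneMap U '' orthant d, ψ y * exp (-∑ i, w i * y i)
      = |U.det| * (∏ k, 1 / (∑ i, w i * U i k)) *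
          ∫ ξ in unitCube d, ψ (U *ᵥ logMap (fun k => ∑ i, w i * U i k) ξ) := by
  rw [integral_cone_mul_exp_neg hU w ψ]
  have hD := integral_unitCube_comp_logMap (fun k => ∑ i, w i * U i k) hc (fun l => ψ (U *ᵥ l))
  beta_reduce at hD
  rw [hD]
  have hP : ∏ k, (∑ i, w i * U i k) ≠ 0 := Finset.prod_ne_zero_iff.mpr fun k _ => (hc k).ne'
  rw [Finset.prod_div_distrib, Finset.prod_const_one]
  field_simp


/-! ## The chain (Weyl-chamber) cone: nested indicator generators, `|det| = 1`, and eq. (40)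

For the braid-fan cone `C_σ` the generators are (minus) the indicators of the chain sets, `u^{(σ,k)} = −1_{A^σ_k}` (eq.
(CsigmaWeylexplicit), tex l.1007), "From the form of the u^{(σ,k)} vectors … it is obvious that |det(u^{(σ,1)}, …, u^{(σ,n−1)}, 𝟙)| = 1"
(l.1081) and "⟨u^{(σ,k)}, w^{(σ,z_ℬ)}⟩ − ⟨u^{(σ,k)}, w^{(σ,z_𝒜)}⟩ = z_𝒜(A^σ_k) − z_ℬ(A^σ_k)" (l.1079–1080), whence eq. (40)
"I^tr_{C_σ} = 1/Π_{k=1}^{n−1} r(A^σ_k)". We type this in POSITION coordinates (the chain relabelled to 0 < 1 < … < d−1, so A_{k+1} =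
{0,…,k}) and with the IR/SE lane's sign convention (`irse/B-SAMPLER-DESIGN.md` 6.1: τ_L = −log t_L ≥ 0, "r ↔ w(r) = Σ_L r_L 1_{S_L}",
"m₁(r) … piecewise linear on the chain cone"): generator k = `+1_{A_{k+1}}` (column k of `chainMatrix d`), so `⟨u^{(k)}, w⟩ = Σ_{j ≤ k} w_j`
(`sum_mul_chainMatrix`), `det = 1` (`det_chainMatrix`), and Lemma 17 gives **eq. (40)**: `∫_{chain cone} e^{−⟨y,w⟩} dy = Π_k 1/(Σ_{j≤k} w_j)`
(`integral_chainCone_exp_neg`, with r(A_{k+1}) = Σ_{j≤k} w_j) and the sampling law "gaps τ_k ~ Exp(Σ_{j≤k} w_j) independent,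
y = Σ_k τ_k 1_{A_{k+1}}" (`integral_orthant_expDensity_comp_chainMatrix`). -/

/-- The chain-cone generator matrix in position coordinates: column `k` is the indicator `1_{A_{k+1}}` of the positions `j ≤ k`
(Borinsky's `u^{(σ,k)} = −1_{A^σ_k}` up to the global sign `y = −τ`). [cite: Borinsky2020, eq. (CsigmaWeylexplicit) (tex l.1007); Theorem 27 proof (tex l.1079–1081)] -/
def chainMatrix (d : ℕ) : Matrix (Fin d) (Fin d) ℝ := fun j k => if j ≤ k then 1 else 0

/-- `chainMatrix` is upper triangular with unit diagonal, so **`det = 1`** ("it is obvious that |det(u^{(σ,1)}, …, u^{(σ,n−1)}, 𝟙)| = 1").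
[cite: Borinsky2020, Theorem 27 proof (tex l.1081)] -/
theorem det_chainMatrix : (chainMatrix d).det = 1 := by
  have hT : (chainMatrix d).BlockTriangular id := by
    intro i j hij
    simp only [chainMatrix, id] at hij ⊢
    rw [if_neg (not_le.mpr hij)]
  rw [Matrix.det_of_upperTriangular hT]
  exact Finset.prod_eq_one fun i _ => by simp [chainMatrix]

/-- `⟨1_{A_{k+1}}, w⟩ = Σ_{j ≤ k} w_j`: the pairing of the `k`-th chain generator with `w` is the partial (chain-set) sum
("⟨u^{(σ,k)}, w^{(σ,z)}⟩ = −z(A^σ_k)" together with Σ_{A^σ_k} w^{(σ,z)} = z(A^σ_k)). [cite: Borinsky2020, Theorem 27 proof (tex l.1079–1080)] -/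
theorem sum_mul_chainMatrix (w : Fin d → ℝ) (k : Fin d) :
    ∑ i, w i * chainMatrix d i k = ∑ i ∈ Finset.univ.filter (fun i : Fin d => i ≤ k), w i := by
  rw [Finset.sum_filter]
  exact Finset.sum_congr rfl fun i _ => by unfold chainMatrix; split_ifs <;> simp

/-- `(chainMatrix d) τ` has coordinates `y_j = Σ_{k ≥ j} τ_k` (log-depths from gaps: "w(r) = Σ_L r_L 1_{S_L}").
[cite: Borinsky2020, eq. (CsigmaWeylexplicit) (tex l.1007)] -/
theorem chainMatrix_mulVec (τ : Fin d → ℝ) (j : Fin d) :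
    (chainMatrix d *ᵥ τ) j = ∑ k ∈ Finset.univ.filter (fun k : Fin d => j ≤ k), τ k := by
  simp only [Matrix.mulVec, dotProduct, chainMatrix]
  rw [Finset.sum_filter]
  exact Finset.sum_congr rfl fun k _ => by split_ifs <;> simp

/-- **Eq. (40) from Lemma 17**: `∫_{chain cone} e^{−⟨y,w⟩} dy = Π_k 1/(Σ_{j≤k} w_j)` whenever every chain-set sum `Σ_{j≤k} w_j` is
positive — "I^tr_{C_σ} = 1/Π_{k=1}^{n−1} r(A^σ_k)" with `r(A_{k+1}) = Σ_{j≤k} w_j` and `|det| = 1`.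
[cite: Borinsky2020, eq. (40) (tex l.1102–1105); Theorem 27 (tex l.1063–1084); Lemma 17] -/
theorem integral_chainCone_exp_neg (w : Fin d → ℝ) (hc : ∀ k : Fin d, 0 < ∑ i ∈ Finset.univ.filter (fun i : Fin d => i ≤ k), w i) :
    ∫ y in coneMap (chainMatrix d) '' orthant d, exp (-∑ i, w i * y i)
      = ∏ k, 1 / ∑ i ∈ Finset.univ.filter (fun i : Fin d => i ≤ k), w i := by
  have hdet : (chainMatrix d).det ≠ 0 := by rw [det_chainMatrix]; exact one_ne_zero
  have hc' : ∀ k, 0 < ∑ i, w i * chainMatrix d i k := fun k => by rw [sum_mul_chainMatrix]; exact hc k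
  rw [integral_cone_exp_neg hdet w hc', det_chainMatrix, abs_one, one_mul]
  exact Finset.prod_congr rfl fun k _ => by rw [sum_mul_chainMatrix]

/-- **The chain-cone sampling law**: with `c_k = Σ_{j≤k} w_j > 0`, independent gaps `τ_k ~ Exp(c_k)` pushed forward by
`y = Σ_k τ_k 1_{A_{k+1}}` integrate every `φ` against the normalised density `e^{−⟨y,w⟩}·Π_k c_k` on the chain cone (Algorithm 4's
continuous step "κ ← κ ξ^{1/r(A)}" read in log-coordinates; the lane's R0 per-level law when its exponents are the tropical
partial sums). [cite: Borinsky2020, eq. (40); Algorithm 4 / Proposition 31 (tex l.1128–1157); Lemma 17 proof] -/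
theorem integral_orthant_expDensity_comp_chainMatrix (w : Fin d → ℝ)
    (hc : ∀ k : Fin d, 0 < ∑ i ∈ Finset.univ.filter (fun i : Fin d => i ≤ k), w i) (φ : (Fin d → ℝ) → ℝ) :
    ∫ l in orthant d, φ (chainMatrix d *ᵥ l) *
        ∏ k, ((∑ i ∈ Finset.univ.filter (fun i : Fin d => i ≤ k), w i) *
          exp (-((∑ i ∈ Finset.univ.filter (fun i : Fin d => i ≤ k), w i) * l k)))
      = (∏ k, ∑ i ∈ Finset.univ.filter (fun i : Fin d => i ≤ k), w i)
          * ∫ y in coneMap (chainMatrix d) '' orthant d, φ y * exp (-∑ i, w i * y i) := by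
  have hdet : (chainMatrix d).det ≠ 0 := by rw [det_chainMatrix]; exact one_ne_zero
  have hc' : ∀ k, 0 < ∑ i, w i * chainMatrix d i k := fun k => by rw [sum_mul_chainMatrix]; exact hc k
  have h := integral_orthant_expDensity_comp_coneMap hdet w hc' φ
  simp only [sum_mul_chainMatrix, det_chainMatrix, abs_one, one_mul] at h
  rw [h, Finset.prod_div_distrib, Finset.prod_const_one, one_div, one_div, inv_inv]

end

end Literature.MathematicalPhysics.QuantumFieldTheory.Borinsky2020
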